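import Mathlib.Analysis.Matrix.Order
import Mathlib.GroupTheory.OrderOfElement
import Summits.QuantumFields.YangMills.Theorems.BalabanLadderIRcofSchurFejerCore
import Summits.QuantumFields.YangMills.Theorems.ConvexGribovBodyNonSimplyConnectedLatticeGapCentreSplittingOrderTwo
import Summits.QuantumFields.YangMills.Theorems.ConvexGribovBodyNonSimplyConnectedLatticeGapTwistDefs
import HarnessLib

/-!
# Schur–Fejér splitting window — the window ON THE GROUP and the weight `w = E_β · W_N` (rev 4; PROVED, 0 sorry)

Ideator `ym-ir-idea-22` g4 · crux `IRcof` (stmt-QuantumFields-26930) · line `Cruxes/IRcof/Lines/equipartition_seam.lean` rev 4,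
§7 (A) and crux idea `Ideas/schur-fejer-split.md`.  The SCALAR CORE (`gs ∕ spow ∕ fejerSum ∕ sosForm`, `fejerSum_eq_sosForm`, `fejerSum_rootOfUnity`, `fejerSum_exact`, …) is the landed
`Theorems/BalabanLadderIRcofSchurFejerCore.lean` (p669107, same namespace), used BY NAME through the import.

NEW CONTENT (all proved):
§1 scalar complements — `spow_conj`, `fejerSum_conj` (`G_N(ū) = conj G_N(u)`), `ofReal_fejerSum_re`, `norm_fejerSum_le` (`|G_N| ≤ N²` on
   the closed disc), `fejerSum_re_le`, `continuous_fejerSum`.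
§2 `posSemidef_fejerSum` — the Fejér kernel matrix `(G_N(M_ij))_{ij}` of a PSD complex matrix `M` is PSD (Mathlib's Schur product
   theorem `Matrix.PosSemidef.hadamard`, iterated: `posSemidef_hadPow`; conjugate powers are transposes: `posSemidef_hadPow_conj`).
§3 THE WINDOW ON THE GROUP, `window ρH N h = Re G_N(u(h))/N²`, `u = nchar ρH = tr ρH / dim ρH`, for a faithful unitary
   `ρH : LatticeRep H`: `continuous_window`, `window_nonneg` (EVERYWHERE, by the SOS identity + `|tr U| ≤ dim`), `window_le_one`,
   `window_inv`, `window_conj`, `window_posType` (clause-5 shape of `TwistSplitWeight`; via `posSemidef_nchar_gram`: the Gram matrix of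
   `u` is `dim⁻¹ · Bᴴ B`, and `posSemidef_window_gram`), `window_one`; and for `Γ = zpowers k₀`, `orderOf k₀ = N`, `ρH k₀ = ω • 1`,
   `ω` a primitive `N`-th root: `window_kernel_zero` (`W_N = 0` on `Γ ∖ {1}`) and `window_exact` (`∑ᶠ k ∈ Γ, W_N(k h) = 1`).
   Bundled: `fejerWindow_cyclic` = the body of the crux idea's first lemma `FejerWindowExists` in the cyclic-scalar case
   (`SU(N) → PSU(N)` with `ρH` fundamental; `SU(2) → SO(3)`), nine clauses.

NOT here: §4, the Laplace step (clause 7), the general finite central `Γ`.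
HONEST: YM mass gap (Clay) NOT proved; `IRcof` 0∕1; this is algebra for one stub (S2ᵛ) of one registered line (row 47, mechanism 0).

LANDING NOTE (custody LEAD ym-ir-line-ab-p1 g7; source `Cruxes/IRcof/Lines/equipartition_seam_SchurFejerCore.lean` rev 4 9f3231cc9009, ym-ir-idea-22 g4;
crit-3 g4 GATE WORD 21:29:59Z K1′–K4′): §1–§3 verbatim; gate-forced only: one-line docstrings; namespace kept (K3′: no wholesale `open` downstream).
-/

set_option autoImplicit false

noncomputable section

open Finset Complex

namespace Summit.QuantumFields.YangMills.Cruxes.IRcof.EquipartitionSeam.SchurFejer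

/-! ### §1 Scalar complements: conjugation symmetry, bounds, continuity -/

/-- `spow` commutes with complex conjugation. -/
lemma spow_conj (u : ℂ) (j l : ℕ) : spow (starRingEnd ℂ u) j l = starRingEnd ℂ (spow u j l) := by
  unfold spow
  split_ifs <;> simp [map_pow]

/-- `G_N(ū) = conj (G_N u)`. -/
lemma fejerSum_conj (u : ℂ) (N : ℕ) :
    fejerSum (starRingEnd ℂ u) N = starRingEnd ℂ (fejerSum u N) := by
  simp only [fejerSum, map_sum, spow_conj]

/-- `Re G_N(ū) = Re G_N(u)`. -/
lemma fejerSum_conj_re (u : ℂ) (N : ℕ) : (fejerSum (starRingEnd ℂ u) N).re = (fejerSum u N).re := by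
  rw [fejerSum_conj, Complex.conj_re]

/-- `G_N(u)` is real: `((Re G_N(u) : ℝ) : ℂ) = G_N(u)`. -/
lemma ofReal_fejerSum_re (u : ℂ) (N : ℕ) : (((fejerSum u N).re : ℝ) : ℂ) = fejerSum u N :=
  Complex.ext (by simp) (by simp [fejerSum_im])

/-- `|u^{(j−l)}| ≤ 1` on the closed unit disc. -/
lemma norm_spow_le (u : ℂ) (hu : ‖u‖ ≤ 1) (j l : ℕ) : ‖spow u j l‖ ≤ 1 := by
  unfold spow
  split_ifs
  · rw [norm_pow]; exact pow_le_one₀ (norm_nonneg _) hu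
  · rw [norm_pow, Complex.norm_conj]; exact pow_le_one₀ (norm_nonneg _) hu

/-- `|G_N(u)| ≤ N²` on the closed unit disc. -/
lemma norm_fejerSum_le (u : ℂ) (hu : ‖u‖ ≤ 1) (N : ℕ) : ‖fejerSum u N‖ ≤ (N : ℝ) ^ 2 := by
  unfold fejerSum
  calc ‖∑ j ∈ range N, ∑ l ∈ range N, spow u j l‖
        ≤ ∑ j ∈ range N, ‖∑ l ∈ range N, spow u j l‖ := norm_sum_le _ _
    _ ≤ ∑ j ∈ range N, ∑ l ∈ range N, ‖spow u j l‖ :=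
        Finset.sum_le_sum fun j _ => norm_sum_le _ _
    _ ≤ ∑ j ∈ range N, ∑ l ∈ range N, (1 : ℝ) :=
        Finset.sum_le_sum fun j _ => Finset.sum_le_sum fun l _ => norm_spow_le u hu j l
    _ = (N : ℝ) ^ 2 := by simp [sq]

/-- `Re G_N(u) ≤ N²` on the closed unit disc. -/
lemma fejerSum_re_le (u : ℂ) (hu : ‖u‖ ≤ 1) (N : ℕ) : (fejerSum u N).re ≤ (N : ℝ) ^ 2 :=
  (Complex.re_le_norm _).trans (norm_fejerSum_le u hu N)

/-- `u ↦ u^{(j−l)}` is continuous. -/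
lemma continuous_spow (j l : ℕ) : Continuous fun u : ℂ => spow u j l := by
  unfold spow
  split_ifs
  · exact continuous_pow _
  · exact Complex.continuous_conj.pow _

/-- `u ↦ G_N(u)` is continuous. -/
lemma continuous_fejerSum (N : ℕ) : Continuous fun u : ℂ => fejerSum u N := by
  unfold fejerSum
  exact continuous_finsetSum _ fun j _ => continuous_finsetSum _ fun l _ => continuous_spow j l

/-! ### §2 The Fejér kernel matrix of a PSD matrix is PSD (Schur product theorem) -/

section PSD

open scoped ComplexOrder

variable {m : Type} [Fintype m]

/-- Entrywise (Hadamard) power of a square complex matrix. -/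
def hadPow (M : Matrix m m ℂ) (k : ℕ) : Matrix m m ℂ := Matrix.of fun i j => M i j ^ k

omit [Fintype m] in
/-- The zeroth Hadamard power is the all-ones matrix. -/
lemma hadPow_zero (M : Matrix m m ℂ) :
    hadPow M 0 = Matrix.vecMulVec (star (fun _ : m => (1 : ℂ))) (fun _ => (1 : ℂ)) := by
  ext i j
  simp [hadPow, Matrix.vecMulVec_apply]

omit [Fintype m] in
/-- Hadamard power recursion `M^{∘(k+1)} = M^{∘k} ∘ M`. -/
lemma hadPow_succ (M : Matrix m m ℂ) (k : ℕ) :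
    hadPow M (k + 1) = Matrix.hadamard (hadPow M k) M := by
  ext i j
  simp [hadPow, pow_succ]

/-- Schur product theorem, iterated: Hadamard powers of a PSD matrix are PSD (Mathlib
`Matrix.PosSemidef.hadamard`; the zeroth power is the all-ones matrix `𝟙 𝟙ᴴ`). -/
theorem posSemidef_hadPow {M : Matrix m m ℂ} (hM : M.PosSemidef) (k : ℕ) :
    (hadPow M k).PosSemidef := by
  induction k with
  | zero => rw [hadPow_zero]; exact Matrix.posSemidef_vecMulVec_star_self _
  | succ k ih => rw [hadPow_succ]; exact ih.hadamard hM

/-- Hadamard powers of the entrywise CONJUGATE of a PSD matrix are PSD (they are the transposes of the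
Hadamard powers, `M` being Hermitian). -/
theorem posSemidef_hadPow_conj {M : Matrix m m ℂ} (hM : M.PosSemidef) (k : ℕ) :
    (Matrix.of fun i j => (starRingEnd ℂ (M i j)) ^ k).PosSemidef := by
  have h : (Matrix.of fun i j => (starRingEnd ℂ (M i j)) ^ k) = (hadPow M k).transpose := by
    ext i j
    have hij : starRingEnd ℂ (M i j) = M j i := by
      have := hM.isHermitian.apply j i
      simpa using this
    simp [hadPow, hij]
  rw [h]
  exact (posSemidef_hadPow hM k).transpose

/-- The signed-power kernel matrix `(M_ij^{(a−b)})` of a PSD matrix is PSD. -/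
theorem posSemidef_spow {M : Matrix m m ℂ} (hM : M.PosSemidef) (a b : ℕ) :
    (Matrix.of fun i j => spow (M i j) a b).PosSemidef := by
  by_cases h : b ≤ a
  · simp only [spow, if_pos h]
    exact posSemidef_hadPow hM (a - b)
  · simp only [spow, if_neg h]
    exact posSemidef_hadPow_conj hM (b - a)

/-- **The Fejér kernel matrix `(G_N(M_ij))_{ij}` of a PSD matrix `M` is PSD** — the Schur product theorem
plus the double-sum form of `G_N` (no coefficients needed: each `(M_ij^{(a−b)})_{ij}` is PSD). -/
theorem posSemidef_fejerSum {M : Matrix m m ℂ} (hM : M.PosSemidef) (N : ℕ) :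
    (Matrix.of fun i j => fejerSum (M i j) N).PosSemidef := by
  have h : (Matrix.of fun i j => fejerSum (M i j) N) =
      ∑ a ∈ range N, ∑ b ∈ range N, Matrix.of fun i j => spow (M i j) a b := by
    ext i j
    simp [fejerSum, Matrix.sum_apply]
  rw [h]
  exact Matrix.posSemidef_sum _ fun a _ => Matrix.posSemidef_sum _ fun b _ => posSemidef_spow hM a b

end PSD

/-! ### §3 The Schur–Fejér window on the group, for a cyclic kernel acting by scalars in `ρH`

For a faithful unitary lattice representation `ρH` of `H` (`LatticeRep`: the cells of `TwistSplitWeight`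
are cut by `Re tr ρH`), put `u := tr ρH / dim ρH` and `W_N(h) := G_N(u(h)) / N²`.  Below: `W_N` is continuous,
`0 ≤ W_N ≤ 1`, inversion- and conjugation-invariant, OF POSITIVE TYPE (its Gram matrices are PSD: Gram matrix of
`u` is `Bᴴ B / dim`, then `posSemidef_fejerSum`), `W_N(1) = 1`; and if `k₀ ∈ H` acts in `ρH` by the scalar `ω`,
a primitive `N`-th root of unity (so `Γ := ⟨k₀⟩ ≅ ℤ_N`, e.g. the centre of `SU(N)` in the fundamental), then
`W_N = 0` on `Γ ∖ {1}` and `Σ_{k ∈ Γ} W_N(k h) = 1` EXACTLY.  This is the body of the crux idea's first lemma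
`FejerWindowExists` in the cyclic-scalar case; the splitting weight of S2ᵛ is `w := E_β · W_N`
(`E_β(h) = exp (β Re tr r(π h))`, positive type of the product = one more `Matrix.PosSemidef.hadamard`). -/

section Window

open Literature.MathematicalPhysics.QuantumFieldTheory
open Summit.QuantumFields.YangMills.Theorems.NonSimplyConnectedLatticeGap (latticeRep_map_inv)
open scoped ComplexOrder

variable {H : Type} [Group H] [TopologicalSpace H]

/-- Normalised character `u(h) = tr ρH(h) / dim ρH`. -/
def nchar (ρH : LatticeRep H) (h : H) : ℂ := (ρH.ρ h).trace / (ρH.N : ℂ)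

/-- The Schur–Fejér window `W_N(h) = Re G_N(u(h)) / N²`. -/
def window (ρH : LatticeRep H) (N : ℕ) (h : H) : ℝ := (fejerSum (nchar ρH h) N).re / (N : ℝ) ^ 2

/-- `|tr ρH(h)| ≤ dim ρH` (unitarity). -/
lemma norm_trace_le (ρH : LatticeRep H) (h : H) : ‖(ρH.ρ h).trace‖ ≤ ρH.N := by
  calc ‖(ρH.ρ h).trace‖ = ‖∑ i, ρH.ρ h i i‖ := rfl
    _ ≤ ∑ i, ‖ρH.ρ h i i‖ := norm_sum_le _ _
    _ ≤ ∑ _i : Fin ρH.N, (1 : ℝ) :=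
        Finset.sum_le_sum fun i _ => entry_norm_bound_of_unitary (ρH.mem_unitary h) i i
    _ = ρH.N := by simp

/-- The normalised character has modulus `≤ 1`. -/
lemma norm_nchar_le_one (ρH : LatticeRep H) (h : H) : ‖nchar ρH h‖ ≤ 1 := by
  unfold nchar
  rcases Nat.eq_zero_or_pos ρH.N with h0 | hpos
  · simp [h0]
  · rw [norm_div, Complex.norm_natCast]
    exact (div_le_one (by exact_mod_cast hpos)).2 (norm_trace_le ρH h)

/-- `nchar ρH 1 = 1` (positive dimension). -/
lemma nchar_one (ρH : LatticeRep H) (hd : 0 < ρH.N) : nchar ρH 1 = 1 := by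
  unfold nchar
  rw [map_one, Matrix.trace_one, Fintype.card_fin]
  exact div_self (by exact_mod_cast hd.ne')

/-- `nchar ρH h⁻¹ = conj (nchar ρH h)`. -/
lemma nchar_inv (ρH : LatticeRep H) (h : H) : nchar ρH h⁻¹ = starRingEnd ℂ (nchar ρH h) := by
  unfold nchar
  rw [latticeRep_map_inv, Matrix.trace_conjTranspose, Complex.star_def, map_div₀, map_natCast]

/-- The normalised character is a class function. -/
lemma nchar_conj (ρH : LatticeRep H) (g h : H) : nchar ρH (g * h * g⁻¹) = nchar ρH h := by
  unfold nchar
  rw [map_mul, map_mul, Matrix.trace_mul_cycle, ← map_mul, inv_mul_cancel, map_one, one_mul]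

/-- A scalar `k` (`ρH k = ζ·1`) rotates the normalised character: `u(k h) = ζ u(h)`. -/
lemma nchar_scalar_mul (ρH : LatticeRep H) {k : H} {ζ : ℂ}
    (hk : ρH.ρ k = ζ • (1 : Matrix (Fin ρH.N) (Fin ρH.N) ℂ)) (h : H) :
    nchar ρH (k * h) = ζ * nchar ρH h := by
  unfold nchar
  rw [map_mul, hk, Matrix.smul_mul, one_mul, Matrix.trace_smul, smul_eq_mul, mul_div_assoc]

/-- An element acting as the scalar `ζ` has normalised character `ζ`. -/
lemma nchar_scalar (ρH : LatticeRep H) (hd : 0 < ρH.N) {k : H} {ζ : ℂ}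
    (hk : ρH.ρ k = ζ • (1 : Matrix (Fin ρH.N) (Fin ρH.N) ℂ)) : nchar ρH k = ζ := by
  have := nchar_scalar_mul ρH hk 1
  rwa [mul_one, nchar_one ρH hd, mul_one] at this

/-- The normalised character is continuous. -/
lemma continuous_nchar (ρH : LatticeRep H) : Continuous (nchar ρH) :=
  ρH.continuous.matrix_trace.div_const _

/-- Clause 1: the window is continuous. -/
theorem continuous_window (ρH : LatticeRep H) (N : ℕ) : Continuous (window ρH N) :=
  (Complex.continuous_re.comp ((continuous_fejerSum N).comp (continuous_nchar ρH))).div_const _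

/-- Clause 2: the window is non-negative EVERYWHERE on the group (SOS identity + `|tr U| ≤ dim`). -/
theorem window_nonneg (ρH : LatticeRep H) (N : ℕ) (h : H) : 0 ≤ window ρH N h :=
  div_nonneg (fejerSum_re_nonneg _ (norm_nchar_le_one ρH h) N) (sq_nonneg _)

/-- The window is bounded by `1` (`|G_N| ≤ N²` on the disc). -/
theorem window_le_one (ρH : LatticeRep H) (N : ℕ) (h : H) : window ρH N h ≤ 1 := by
  unfold window
  rcases Nat.eq_zero_or_pos N with h0 | hpos
  · simp [h0]
  · exact (div_le_one (by positivity)).2 (fejerSum_re_le _ (norm_nchar_le_one ρH h) N)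

/-- Clause 3: inversion invariance (`u(h⁻¹) = conj u(h)` and `G_N(ū) = conj G_N(u)` is real). -/
theorem window_inv (ρH : LatticeRep H) (N : ℕ) (h : H) : window ρH N h⁻¹ = window ρH N h := by
  simp only [window, nchar_inv, fejerSum_conj_re]

/-- Clause 4: conjugation invariance. -/
theorem window_conj (ρH : LatticeRep H) (N : ℕ) (g h : H) :
    window ρH N (g * h * g⁻¹) = window ρH N h := by
  simp only [window, nchar_conj]

/-- `Re ((N : ℂ)²) = N²`. -/
lemma natCast_sq_re (N : ℕ) : ((N : ℂ) ^ 2).re = (N : ℝ) ^ 2 := by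
  simp [sq, Complex.mul_re]

/-- `W_N(1) = 1`. -/
theorem window_one (ρH : LatticeRep H) (hd : 0 < ρH.N) {N : ℕ} (hN : 0 < N) : window ρH N 1 = 1 := by
  unfold window
  rw [nchar_one ρH hd, fejerSum_one, natCast_sq_re]
  exact div_self (by positivity)

/-- `W_N(k) = 0` for a scalar `k` acting by a non-trivial `N`-th root of unity (Fejér zeros). -/
theorem window_scalar_zero (ρH : LatticeRep H) (hd : 0 < ρH.N) (N : ℕ) {k : H} {ζ : ℂ}
    (hk : ρH.ρ k = ζ • (1 : Matrix (Fin ρH.N) (Fin ρH.N) ℂ)) (hζN : ζ ^ N = 1) (hζ1 : ζ ≠ 1) :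
    window ρH N k = 0 := by
  unfold window
  rw [nchar_scalar ρH hd hk, fejerSum_rootOfUnity ζ N hζN hζ1, Complex.zero_re, zero_div]

/-- EXACTNESS over the `N` rotations by `k₀` (`ρH k₀ = ω·1`, `ω` a primitive `N`-th root). -/
theorem window_exact_range (ρH : LatticeRep H) {N : ℕ} (hN : 0 < N) {ω : ℂ}
    (hω : IsPrimitiveRoot ω N) {k₀ : H} (hk₀ : ρH.ρ k₀ = ω • (1 : Matrix (Fin ρH.N) (Fin ρH.N) ℂ))
    (h : H) : ∑ m ∈ range N, window ρH N (k₀ ^ m * h) = 1 := by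
  have hpow : ∀ m : ℕ, ρH.ρ (k₀ ^ m) = (ω ^ m) • (1 : Matrix (Fin ρH.N) (Fin ρH.N) ℂ) := fun m => by
    rw [map_pow, hk₀, smul_pow, one_pow]
  unfold window
  simp_rw [nchar_scalar_mul ρH (hpow _) h]
  rw [← Finset.sum_div, ← Complex.re_sum, fejerSum_exact ω _ N hω, natCast_sq_re]
  exact div_self (by positivity)

/-- **Positive type, matrix form.** The Gram matrix `(u(x_i⁻¹ x_j))_{ij}` of the normalised character of a
unitary representation is PSD: it is `dim⁻¹ · Bᴴ B` with `B_{(a,b), j} = ρH(x_j)_{ab}`. -/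
theorem posSemidef_nchar_gram (ρH : LatticeRep H) {n : ℕ} (x : Fin n → H) :
    (Matrix.of fun i j : Fin n => nchar ρH ((x i)⁻¹ * x j)).PosSemidef := by
  set B : Matrix (Fin ρH.N × Fin ρH.N) (Fin n) ℂ := Matrix.of fun ab j => ρH.ρ (x j) ab.1 ab.2 with hB
  have hT : (Matrix.of fun i j : Fin n => (ρH.ρ ((x i)⁻¹ * x j)).trace) = B.conjTranspose * B := by
    ext i j
    simp only [Matrix.of_apply, map_mul, latticeRep_map_inv, Matrix.trace, Matrix.diag_apply,
      Matrix.mul_apply, Matrix.conjTranspose_apply, hB, Fintype.sum_prod_type]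
    rw [Finset.sum_comm]
  have hTpsd : (Matrix.of fun i j : Fin n => (ρH.ρ ((x i)⁻¹ * x j)).trace).PosSemidef := by
    rw [hT]; exact Matrix.posSemidef_conjTranspose_mul_self B
  have hc : (0 : ℂ) ≤ (((ρH.N : ℝ)⁻¹ : ℝ) : ℂ) :=
    Complex.zero_le_real.2 (inv_nonneg.2 (Nat.cast_nonneg _))
  have heq : (Matrix.of fun i j : Fin n => nchar ρH ((x i)⁻¹ * x j)) =
      (((ρH.N : ℝ)⁻¹ : ℝ) : ℂ) • (Matrix.of fun i j : Fin n => (ρH.ρ ((x i)⁻¹ * x j)).trace) := by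
    ext i j
    simp only [Matrix.of_apply, Matrix.smul_apply, smul_eq_mul, nchar, Complex.ofReal_inv,
      Complex.ofReal_natCast]
    rw [div_eq_inv_mul]
  rw [heq]
  exact hTpsd.smul hc

/-- **Positive type, matrix form, for the window**: the Gram matrix `(W_N(x_i⁻¹ x_j))_{ij}` is PSD
(`posSemidef_fejerSum` on the Gram matrix of `u`, scaled by `N⁻²`). -/
theorem posSemidef_window_gram (ρH : LatticeRep H) (N : ℕ) {n : ℕ} (x : Fin n → H) :
    (Matrix.of fun i j : Fin n => ((window ρH N ((x i)⁻¹ * x j) : ℝ) : ℂ)).PosSemidef := by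
  have hF := posSemidef_fejerSum (posSemidef_nchar_gram ρH x) N
  have hc : (0 : ℂ) ≤ ((((N : ℝ) ^ 2)⁻¹ : ℝ) : ℂ) := Complex.zero_le_real.2 (inv_nonneg.2 (sq_nonneg _))
  have heq : (Matrix.of fun i j : Fin n => ((window ρH N ((x i)⁻¹ * x j) : ℝ) : ℂ)) =
      ((((N : ℝ) ^ 2)⁻¹ : ℝ) : ℂ) •
        Matrix.of fun i j : Fin n => fejerSum (nchar ρH ((x i)⁻¹ * x j)) N := by
    ext i j
    simp only [Matrix.of_apply, Matrix.smul_apply, smul_eq_mul, window, Complex.ofReal_div,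
      ofReal_fejerSum_re, Complex.ofReal_inv]
    rw [div_eq_inv_mul]
  rw [heq]
  exact hF.smul hc

/-- Clause 5 (**positive type**, in the form used by `TwistSplitWeight`). -/
theorem window_posType (ρH : LatticeRep H) (N : ℕ) (n : ℕ) (x : Fin n → H) (v : Fin n → ℂ) :
    0 ≤ (∑ i, ∑ j, (starRingEnd ℂ) (v i) * v j * ((window ρH N ((x i)⁻¹ * x j) : ℝ) : ℂ)).re := by
  have hq := (posSemidef_window_gram ρH N x).dotProduct_mulVec_nonneg v
  have hexp : (∑ i, ∑ j, (starRingEnd ℂ) (v i) * v j * ((window ρH N ((x i)⁻¹ * x j) : ℝ) : ℂ)) =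
      dotProduct (star v)
        (Matrix.mulVec (Matrix.of fun i j : Fin n => ((window ρH N ((x i)⁻¹ * x j) : ℝ) : ℂ)) v) := by
    simp only [dotProduct, Matrix.mulVec, Matrix.of_apply, Pi.star_apply, Complex.star_def,
      Finset.mul_sum]
    refine Finset.sum_congr rfl fun i _ => Finset.sum_congr rfl fun j _ => ?_
    ring
  rw [hexp]
  exact (Complex.nonneg_iff.1 hq).1

/-- `W_N = 0` on `Γ ∖ {1}` for the cyclic group `Γ = ⟨k₀⟩` of order `N` acting by `ω` in `ρH`. -/
theorem window_kernel_zero (ρH : LatticeRep H) (hd : 0 < ρH.N) (Γ : Subgroup H) {k₀ : H}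
    (hΓ : Γ = Subgroup.zpowers k₀) {N : ℕ} (hN : orderOf k₀ = N) (hNpos : 0 < N) {ω : ℂ}
    (hω : IsPrimitiveRoot ω N) (hk₀ : ρH.ρ k₀ = ω • (1 : Matrix (Fin ρH.N) (Fin ρH.N) ℂ))
    {k : H} (hk : k ∈ Γ) (hk1 : k ≠ 1) : window ρH N k = 0 := by
  classical
  have hfin : IsOfFinOrder k₀ := orderOf_pos_iff.1 (hN ▸ hNpos)
  rw [hΓ, hfin.mem_zpowers_iff_mem_range_orderOf, hN, Finset.mem_image] at hk
  obtain ⟨m, hm, rfl⟩ := hk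
  have hm' : m < N := Finset.mem_range.1 hm
  have hm0 : 0 < m := Nat.pos_of_ne_zero (by rintro rfl; exact hk1 (pow_zero k₀))
  have hρ : ρH.ρ (k₀ ^ m) = (ω ^ m) • (1 : Matrix (Fin ρH.N) (Fin ρH.N) ℂ) := by
    rw [map_pow, hk₀, smul_pow, one_pow]
  refine window_scalar_zero ρH hd N hρ ?_ (hω.pow_ne_one_of_pos_of_lt hm0.ne' hm')
  rw [← pow_mul, mul_comm, pow_mul, hω.pow_eq_one, one_pow]

/-- Clause 6 (**EXACTNESS**) over the cyclic group `Γ = ⟨k₀⟩`: `Σ_{k ∈ Γ} W_N(k h) = 1`. -/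
theorem window_exact (ρH : LatticeRep H) (Γ : Subgroup H) {k₀ : H}
    (hΓ : Γ = Subgroup.zpowers k₀) {N : ℕ} (hN : orderOf k₀ = N) (hNpos : 0 < N) {ω : ℂ}
    (hω : IsPrimitiveRoot ω N) (hk₀ : ρH.ρ k₀ = ω • (1 : Matrix (Fin ρH.N) (Fin ρH.N) ℂ)) (h : H) :
    ∑ᶠ k ∈ (Γ : Set H), window ρH N (k * h) = 1 := by
  classical
  have hfin : IsOfFinOrder k₀ := orderOf_pos_iff.1 (hN ▸ hNpos)
  have hset : (Γ : Set H) = ↑((Finset.range N).image (k₀ ^ ·)) := by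
    ext y
    rw [hΓ, SetLike.mem_coe, hfin.mem_zpowers_iff_mem_range_orderOf, hN, Finset.mem_coe]
  rw [hset, finsum_mem_coe_finset, Finset.sum_image]
  · exact window_exact_range ρH hNpos hω hk₀ h
  · intro a ha b hb hab
    have ha' : a < N := by simpa using ha
    have hb' : b < N := by simpa using hb
    exact pow_injOn_Iio_orderOf (Set.mem_Iio.2 (hN ▸ ha')) (Set.mem_Iio.2 (hN ▸ hb')) hab

/-- **THE WINDOW LEMMA (cyclic-scalar kernel)** — the body of the crux idea's first lemma `FejerWindowExists`
for `Γ = ⟨k₀⟩ ≅ ℤ_N` acting in the faithful `ρH` by a primitive `N`-th root of unity `ω` (e.g. `SU(N) → PSU(N)`,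
`ρH` fundamental; `SU(2) → SO(3)`): all nine clauses. -/
theorem fejerWindow_cyclic (ρH : LatticeRep H) (hd : 0 < ρH.N) (Γ : Subgroup H) {k₀ : H}
    (hΓ : Γ = Subgroup.zpowers k₀) {N : ℕ} (hN : orderOf k₀ = N) (hNpos : 0 < N) {ω : ℂ}
    (hω : IsPrimitiveRoot ω N) (hk₀ : ρH.ρ k₀ = ω • (1 : Matrix (Fin ρH.N) (Fin ρH.N) ℂ)) :
    Continuous (window ρH N) ∧ (∀ h, 0 ≤ window ρH N h) ∧ (∀ h, window ρH N h ≤ 1) ∧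
      (∀ h, window ρH N h⁻¹ = window ρH N h) ∧ (∀ g h, window ρH N (g * h * g⁻¹) = window ρH N h) ∧
      (∀ (n : ℕ) (x : Fin n → H) (v : Fin n → ℂ),
        0 ≤ (∑ i, ∑ j, (starRingEnd ℂ) (v i) * v j * ((window ρH N ((x i)⁻¹ * x j) : ℝ) : ℂ)).re) ∧
      window ρH N 1 = 1 ∧ (∀ k ∈ Γ, k ≠ 1 → window ρH N k = 0) ∧
      (∀ h, ∑ᶠ k ∈ (Γ : Set H), window ρH N (k * h) = 1) :=
  ⟨continuous_window ρH N, window_nonneg ρH N, window_le_one ρH N, window_inv ρH N, window_conj ρH N,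
    window_posType ρH N, window_one ρH hd hNpos,
    fun _ hk hk1 => window_kernel_zero ρH hd Γ hΓ hN hNpos hω hk₀ hk hk1,
    window_exact ρH Γ hΓ hN hNpos hω hk₀⟩

end Window
end Summit.QuantumFields.YangMills.Cruxes.IRcof.EquipartitionSeam.SchurFejer

end
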